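import Summits.BirchSwinnertonDyer.Rank1Residual.ManinAdditive.CMGammaOneRootLawInertThree
import Summits.BirchSwinnertonDyer.Rank1Residual.ManinAdditive.CMGammaOneRootLawTwoLocalBeyond
import Literature.NumberTheory.EllipticCurves.ModularCurveNeronLatticeProofs
import HarnessLib

/-!
# The `ℚ(√−7)` CM classes member by member: SHAPE₇⁺, the index-`2` containment `Λ(V') ⊆ Λ(W)` and the
# class-wise root `Γ₁(N)`-laws at `2` and `3` (cell `bsd-f2-manin`, planner `es` g32, MEMO-es §51; FILE A⁶ = this
# file, lands AFTER `…CMGammaOneRootLawInertThree` (E-es-157, landed) and `…CMGammaOneRootLawTwoLocalBeyond`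
# (E-es-159, FILE A⁵))

TYPER NOTE (typer g21, T-es-56).  SOURCE = HOME/es/g32/ClassSeven-es-g32.lean sha16 ecfc2c1c3e988483 (234 l.; es: body-identical scratch
ClassSeven-scratch.lean e0aec9cdaef9e399 farm rc 0 · 0 · 0 · 0 — the A⁵ import replaced there by a verbatim copy of E-es-159; typer: own farm
check of THIS text against the landed A⁵ rc 0 · 0 warnings) VERBATIM except this note.  FILE A⁶ of es's CM series, ns
`…ManinAdditive.KatoCurve.CMTwinMinimal` §11; lands AFTER A⁵ `…CMGammaOneRootLawTwoLocalBeyond` (T-es-55, p734908) and imports it +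
`…CMGammaOneRootLawInertThree` (p732653) + `Literature…ModularCurveNeronLatticeProofs` + HarnessLib — route-independent.  CONTENT (es MEMO-es
§51): ONE plain `def … : Prop` **SHAPE₇⁺ `CMClassMembersSeven`** (classical classification hypothesis on ℚ(√−7)-CM isogeny classes — same
status as the landed SHAPE₂⁺/₃⁺ `CMClassMembersTwo/Three` (p729412, REF1 §R173); census-backed SHAPE7-CHECK-v1 559f1a138f2ca1b3: 54/54
classes N < 5·10⁵, 108/108 order-2 members with (c₄, c₆)(W) = (17·c₄(V′), 57·c₆(V′)) exactly and Ω₁(W)/Ω₁(V′) = 1/2; NOT tagged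
`@[conjecture]` by es, kept so — it is a printed-classification input, audit R-es-77 PENDING) and 8 PROVED theorems: the analytic Vélu lemma
`lattice_le_of_velu_two_kleinian` (49a1 → 49a2 shape), THEOREM 51 `exists_lattice_le_on_cmClass_seven_of_classMembers`, THEOREM 51₂/51₃
`rootLawAtTwo/Three_on_cmClass_seven_of_classMembers` (the ℚ(√−7) slices of E-es-159 / E-es-157 hold CLASS-WISE, hypotheses = those landed
nodes + SHAPE₇⁺ + Faltings), COR 51.S₂/S₃ (Stevens p ∤ c₁ whichever member is X₁(N)-optimal) and COR 51.R₂/R₃ (C2/C3 p ∤ c₀ for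
lattice-optimal X₀-data, q = 7).  Closes es's residuals R49/R50 on ℚ(√−7) modulo the nodes.  No new conjecture node.  es asked for
`--supports stmt-BirchSwinnertonDyer-22967`; refused by the gate for `…/ManinAdditive/` targets (gotcha 108) — bears_on carried here:
stmt-BirchSwinnertonDyer-22967 (C2), stmt-BirchSwinnertonDyer-22968 (C3).  REFUTER: ref1 R-es-77 (SHAPE₇⁺ anatomy + minimality of Vélu's
model at 2 and 7; THM 51/COR 51 by name) PENDING at landing.  Typer checks: 9 decl names fresh tree-wide; cite keys SilvermanAEC2009 /
Velu1971 / ChiloyanLozanoRobledo2021 / CremonaAlgorithms1997 all in references.bib; no instances, no notation; `--kind statement` (one def).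
PARTITION 0 · beyond-print theorem: no · BSD is not proved by this; C2/C3 OPEN.

Contents (all kernel-checked, NO new conjecture node): the analytic Vélu lemma for the `49a1 → 49a2` shape
(`lattice_le_of_velu_two_kleinian`), the classical classification fact SHAPE₇⁺ `CMClassMembersSeven` (hypothesis,
`def … : Prop`, census-backed), THEOREM 51 (every globally minimal member `W` of a `ℚ(√−7)`-CM class has `j = −3375`
or contains the Néron lattice of a `j = −3375` member with index `2`), THEOREM 51₂/51₃ (the `ℚ(√−7)` slices of the
root laws E-es-159 at `2` and E-es-157 at `3` hold CLASS-WISE), COR 51.S₂/S₃ (Stevens' `2 ∤ c₁`, `3 ∤ c₁` for the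
`X₁(N)`-optimal curve of every `ℚ(√−7)`-CM class with `4 ∣ N` resp. `9 ∣ N`, whichever member is optimal) and
COR 51.R₂/R₃ (C2/C3 for `X₀(N)`-data, second traceless prime `q = 7` always available).  This closes the residuals
R49 (`p = 3`) and R50 (`p = 2`) of MEMO-es §49–§50 on `ℚ(√−7)`: with §46 (`ℚ(i)`, `ℚ(√−3)`) and the seven fields whose
classes are `j`-constant, the CM loci of C2 (`4 ∣ N`) and C3 (`9 ∣ N`) are typed MEMBER BY MEMBER on all nine
class-number-one fields, modulo the root laws E-es-152/154–160 (paper THEOREM 45/47/48, kernel conjecture nodes) and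
the classical SHAPE facts.
Witness (MEMO-es §51): SHAPE7-CHECK-v1 — all 54 `ℚ(√−7)`-CM classes of conductor `< 5·10⁵` have exactly two
`j = −3375` and two `j = 16581375` members; 108/108 order-`2` members `W` satisfy `(c₄, c₆)(W) = (17·c₄(V'), 57·c₆(V'))`
for a `j = −3375` member `V'` EXACTLY, and `Ω₁(W)/Ω₁(V') = 1/2` (AGM real periods; `Λ(V') ⊂ Λ(W)` index `2`); the
`X₀(N)`-optimal curve is a `j = −3375` member in 54/54.  PARTITION 0 · beyond-print theorem: no ·
bears_on stmt-BirchSwinnertonDyer-22967 (C2), stmt-BirchSwinnertonDyer-22968 (C3) · BSD is not proved by this.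
-/

set_option autoImplicit false

noncomputable section

namespace Summit.BirchSwinnertonDyer.Rank1Residual.ManinAdditive.KatoCurve.CMTwinMinimal

open Complex Polynomial WeierstrassCurve Literature.NumberTheory.EllipticCurves
  Literature.NumberTheory.EllipticCurves.ModularForms
  Summit.BirchSwinnertonDyer.Rank1Residual.ManinAdditive.KatoCurve.CMOptimal
  Summit.BirchSwinnertonDyer.Rank1Residual.ManinAdditive.KatoCurve.CMOptimal.TwinLattice

/-! ## §11 The `ℚ(√−7)` classes: the ORDER-`2` members (`j = 16581375`, CM by `ℤ[√−7]`) — SHAPE₇⁺ and the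
class-wise laws at `2` and `3` (MEMO-es §51; closes the residuals R49 / R50 of §49–§50)

A `ℚ(√−7)`-CM isogeny class over `ℚ` has FOUR members: `V`, `V' = V ⊗ χ₋₇` (`j = −3375`, CM by `O_K`,
`√−7`-isogenous) and their quotients `W = V/⟨T⟩`, `W' = V'/⟨T'⟩` by the rational `2`-torsion point (`j = 16581375`,
CM by `ℤ[√−7]`; `49a = {a1, a3; a2, a4}`).  The `j = −3375` members are `(c₄, c₆) = (105u², 1323u³)`, `u ∈ ℤ`
(twists of `49a1`), the half-period has `℘`-value `x₀ = 7u/4`, `B = 3x₀² − g₂/4 = 7u²`, and Vélu's quotient has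
`(c₄, c₆) = (1785u², 75411u³) = (17·c₄, 57·c₆)` — which IS the minimal model of `W` (census SHAPE7-CHECK-v1: all 54
classes of conductor `< 5·10⁵`, 108/108 order-`2` members, exact `(c₄, c₆)` match AND real-period ratio
`Ω₁(W)/Ω₁(V) = 1/2` by AGM; the twist parameters `u` seen cover every class of `ℚ₂^×/ℚ₂^{×2}` and `ℚ₇^×/ℚ₇^{×2}`, so
Tate's algorithm gives the same at every conductor).  Hence `Λ(V') ⊆ Λ(W)` with index `2` for the right `O_K`-member
`V'` (THM 51, kernel), and a ROOT law `Λ₁(f) ⊆ Λ(V') ⊗ ℤ₍ₚ₎` at ANY prime `p` transfers to `W`: the `ℚ(√−7)` slices of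
E-es-159 (`p = 2`, `4 ∣ N`) and E-es-157 (`p = 3`, `9 ∣ N`) hold CLASS-WISE, so Stevens' `p ∤ c₁` and C2/C3's `p ∤ c₀`
follow whichever member is optimal (COR 51). -/

section ClassSeven

open CongruenceSubgroup
open scoped MatrixGroups ModularForm

variable {N : ℕ} [NeZero N]

/-- **Order member at `j = −3375` (index 2) — Vélu on the analytic side.**  A lattice with
`(g₂, g₃) = (35u²/4, 49u³/8)` (the Néron lattice of the globally minimal `j = −3375` curve with
`(c₄, c₆) = (105u², 1323u³)`, e.g. `49a1 = [1,−1,0,−2,−1]` at `u = 1`) is contained in every lattice with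
`(g₂, g₃) = (595u²/4, 2793u³/8)` (`(c₄, c₆) = (1785u², 75411u³)`: Vélu's quotient by the half-period with
`℘ = 7u/4`, `B = 7u²`; `j = 16581375`, CM by `ℤ[√−7]`; the `49a1 → 49a2` shape and its twists).
[cite: SilvermanAEC2009, III.4 Example 4.5] [cite: Velu1971] -/
theorem lattice_le_of_velu_two_kleinian (L L'' : PeriodPair) {u : ℂ} (hu : u ≠ 0)
    (h2 : L.g₂ = 35 / 4 * u ^ 2) (h3 : L.g₃ = 49 / 8 * u ^ 3)
    (h2'' : L''.g₂ = 595 / 4 * u ^ 2) (h3'' : L''.g₃ = 2793 / 8 * u ^ 3) :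
    L.lattice ≤ L''.lattice := by
  obtain ⟨z₀, hz₀, h2z₀, hx₀⟩ := exists_halfPeriod_of_cubic_root L (x := 7 / 4 * u) (by rw [h2, h3]; ring)
  exact (L.lattice_eq_of_velu_invariants hz₀ h2z₀ (B := 7 * u ^ 2) (by rw [hx₀, h2]; ring)
    (mul_ne_zero (by norm_num) (pow_ne_zero 2 hu)) L'' (by rw [h2'', hx₀]; ring) (by rw [h3'', hx₀]; ring)).1

/-- **SHAPE₇⁺ `CMClassMembersSeven` (classical).**  Let `V`, `W` be globally minimal over `ℚ`, `j(V) = −3375`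
(CM by the maximal order of `ℚ(√−7)`), `V ~ W` isogenous over `ℚ`.  Then either `j(W) = −3375`, or `W` is an
ORDER-`2` member: `(c₄, c₆)(W) = (1785u², 75411u³)` (`j(W) = 16581375`, CM by `ℤ[√−7]`) for a `u ≠ 0` such that the
class contains a globally minimal `j = −3375` curve `V'` with `(c₄, c₆)(V') = (105u², 1323u³)`, of which `W` is the
Vélu quotient by the rational `2`-torsion point (`℘ = 7u/4`).  Classical: a curve isogenous over `ℚ` to a
`ℚ(√−7)`-CM curve has CM by an order of `ℚ(√−7)` of class number one (`O_K`, `ℤ[√−7]`: `j ∈ {−3375, 16581375}`),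
the class is `{V, V ⊗ χ₋₇, V/⟨T⟩, (V ⊗ χ₋₇)/⟨T'⟩}` (isogeny degrees `2, 7, 14`), every `j = −3375` curve over `ℚ` is
`(c₄, c₆) = (105u², 1323u³)` (`c₆²/c₄³ = 5103/3375`), and Tate's algorithm shows Vélu's model of the `2`-quotient is
minimal.  Why it might fail: only through a slip in the minimal-model bookkeeping at `2` or `7` (census
SHAPE7-CHECK-v1, es g32 MEMO-es §51: 54/54 classes of conductor `< 5·10⁵`, 108/108 order-`2` members with
`(c₄, c₆)(W) = (17·c₄(V'), 57·c₆(V'))` exactly and `Ω₁(W)/Ω₁(V') = 1/2`; the `u` met, `u ∈ {±d, ±4d, ±8d, 7 ∣ d, …}`,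
exhaust the square classes of `ℚ₂^×` and `ℚ₇^×`).
[cite: ChiloyanLozanoRobledo2021, §3 + CM isogeny-torsion graph table] [cite: SilvermanAEC2009, III.4 Example 4.5; App. C §11]
[cite: CremonaAlgorithms1997, Table 1 (49a, 441d, 784h, 3136d)] -/
def CMClassMembersSeven : Prop :=
  ∀ (V W : WeierstrassCurve ℚ) [V.IsElliptic] [V.IsGloballyMinimal] [W.IsElliptic] [W.IsGloballyMinimal],
    V.j = -3375 → WeierstrassCurve.IsIsogenous V W →
    W.j = -3375 ∨
      ∃ u : ℚ, u ≠ 0 ∧ W.c₄ = 1785 * u ^ 2 ∧ W.c₆ = 75411 * u ^ 3 ∧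
        ∃ (V' : WeierstrassCurve ℚ) (_ : V'.IsElliptic) (_ : V'.IsGloballyMinimal),
          V'.j = -3375 ∧ WeierstrassCurve.IsIsogenous V' W ∧ V'.c₄ = 105 * u ^ 2 ∧ V'.c₆ = 1323 * u ^ 3

/-- **THEOREM 51 (kernel) — every member of a `ℚ(√−7)`-CM class either has `j = −3375` or CONTAINS the Néron lattice of
a `j = −3375` member of its class** (`Λ(V') ⊆ Λ(W)`, index `2`), from SHAPE₇⁺, the uniformisation theorem
(`exists_isNeronLatticeOf_holds`) and Vélu (`lattice_le_of_velu_two_kleinian`). -/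
theorem exists_lattice_le_on_cmClass_seven_of_classMembers (hcl : CMClassMembersSeven)
    (V W : WeierstrassCurve ℚ) [V.IsElliptic] [V.IsGloballyMinimal] [W.IsElliptic] [W.IsGloballyMinimal]
    (LW : PeriodPair) (hjV : V.j = -3375) (hiso : WeierstrassCurve.IsIsogenous V W)
    (hLW : IsNeronLatticeOf (W.baseChange ℂ) LW) :
    W.j = -3375 ∨ ∃ (V' : WeierstrassCurve ℚ) (_ : V'.IsElliptic) (_ : V'.IsGloballyMinimal) (LV' : PeriodPair),
      V'.j = -3375 ∧ WeierstrassCurve.IsIsogenous V' W ∧ IsNeronLatticeOf (V'.baseChange ℂ) LV' ∧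
        LV'.lattice ≤ LW.lattice := by
  rcases hcl V W hjV hiso with hjW | ⟨u, hu, hW4, hW6, V', hE', hmin', hjV', hiso', hV'4, hV'6⟩
  · exact Or.inl hjW
  · haveI := hE'
    haveI := hmin'
    obtain ⟨LV', hLV'⟩ := exists_isNeronLatticeOf_holds (V'.baseChange ℂ)
    refine Or.inr ⟨V', hE', hmin', LV', hjV', hiso', hLV', ?_⟩
    obtain ⟨hV2, hV3⟩ := hLV'
    obtain ⟨hW2, hW3⟩ := hLW
    rw [baseChange_c₄] at hV2 hW2
    rw [baseChange_c₆] at hV3 hW3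
    rw [hV'4] at hV2
    rw [hV'6] at hV3
    rw [hW4] at hW2
    rw [hW6] at hW3
    push_cast at hV2 hV3 hW2 hW3
    have hu0 : ((u : ℚ) : ℂ) ≠ 0 := by exact_mod_cast hu
    exact lattice_le_of_velu_two_kleinian LV' LW hu0 (by rw [hV2]; ring) (by rw [hV3]; ring)
      (by rw [hW2]; ring) (by rw [hW3]; ring)

/-- **THEOREM 51₂ — the `ℚ(√−7)` slice of E-es-159 holds CLASS-WISE**: root law at `2` at the `O_K`-member
(`Λ₁(f) ⊆ Λ(V') ⊗ ℤ₍₂₎`), THM 51 (`Λ(V') ⊆ Λ(W)`), Faltings (`IsNewformOf` along the isogeny) ⟹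
`Λ₁(f) ⊆ Λ(W) ⊗ ℤ₍₂₎` for EVERY globally minimal member `W` of a `ℚ(√−7)`-CM class with `4 ∣ N`. -/
theorem rootLawAtTwo_on_cmClass_seven_of_classMembers (h159 : CMGammaOneRootLawTwoLocalJSqrt7)
    (hcl : CMClassMembersSeven) (hL : LFunction_eq_of_isIsogenous)
    (W : WeierstrassCurve ℚ) [W.IsElliptic] [W.IsGloballyMinimal] (f : CuspForm (Gamma0 N) 2) (LW : PeriodPair)
    (hfW : IsNewformOf W f) (hLW : IsNeronLatticeOf (W.baseChange ℂ) LW)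
    (V : WeierstrassCurve ℚ) [V.IsElliptic] [V.IsGloballyMinimal] (hjV : V.j = -3375)
    (hiso : WeierstrassCurve.IsIsogenous V W) (hN : 2 ^ 2 ∣ N) :
    ∀ z ∈ periodLatticeGamma1 f, ∃ s : ℤ, ¬ (2 : ℤ) ∣ s ∧ (s : ℂ) * z ∈ LW.lattice := by
  intro z hz
  rcases exists_lattice_le_on_cmClass_seven_of_classMembers hcl V W LW hjV hiso hLW with
    hjW | ⟨V', hE', hmin', LV', hjV', hiso', hLV', hle⟩
  · exact h159 W f LW hjW hN hfW hLW z hz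
  · haveI := hE'
    haveI := hmin'
    have hfV' : IsNewformOf V' f := isNewformOf_of_isIsogenous hL hfW hiso'
    obtain ⟨s, hs, hsz⟩ := h159 V' f LV' hjV' hN hfV' hLV' z hz
    exact ⟨s, hs, hle hsz⟩

/-- **THEOREM 51₃ — the `ℚ(√−7)` slice of E-es-157 holds CLASS-WISE** (same transport at `p = 3`, `9 ∣ N`). -/
theorem rootLawAtThree_on_cmClass_seven_of_classMembers (h157 : CMGammaOneRootLawThreeLocalJInert)
    (hcl : CMClassMembersSeven) (hL : LFunction_eq_of_isIsogenous)
    (W : WeierstrassCurve ℚ) [W.IsElliptic] [W.IsGloballyMinimal] (f : CuspForm (Gamma0 N) 2) (LW : PeriodPair)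
    (hfW : IsNewformOf W f) (hLW : IsNeronLatticeOf (W.baseChange ℂ) LW)
    (V : WeierstrassCurve ℚ) [V.IsElliptic] [V.IsGloballyMinimal] (hjV : V.j = -3375)
    (hiso : WeierstrassCurve.IsIsogenous V W) (hN : 3 ^ 2 ∣ N) :
    ∀ z ∈ periodLatticeGamma1 f, ∃ s : ℤ, ¬ (3 : ℤ) ∣ s ∧ (s : ℂ) * z ∈ LW.lattice := by
  intro z hz
  rcases exists_lattice_le_on_cmClass_seven_of_classMembers hcl V W LW hjV hiso hLW with
    hjW | ⟨V', hE', hmin', LV', hjV', hiso', hLV', hle⟩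
  · exact h157 W f LW (Or.inl hjW) hN hfW hLW z hz
  · haveI := hE'
    haveI := hmin'
    have hfV' : IsNewformOf V' f := isNewformOf_of_isIsogenous hL hfW hiso'
    obtain ⟨s, hs, hsz⟩ := h157 V' f LV' (Or.inl hjV') hN hfV' hLV' z hz
    exact ⟨s, hs, hle hsz⟩

/-- **COR 51.S₂ — the `2`-part of STEVENS' `c₁ = ±1` for the `X₁(N)`-optimal curve of EVERY `ℚ(√−7)`-CM class with
`4 ∣ N`, whichever member carries the optimal datum** (E-es-159 + SHAPE₇⁺ + Faltings; closes residual R50 of §50). -/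
theorem not_two_dvd_maninConstant₁_on_cmClass_seven_of_rootLawAtTwo (h159 : CMGammaOneRootLawTwoLocalJSqrt7)
    (hcl : CMClassMembersSeven) (hL : LFunction_eq_of_isIsogenous)
    (W : WeierstrassCurve ℚ) [W.IsElliptic] [W.IsGloballyMinimal] (D : Gamma1ParametrizationData W N)
    (hopt : D.IsOptimal) (V : WeierstrassCurve ℚ) [V.IsElliptic] [V.IsGloballyMinimal] (hjV : V.j = -3375)
    (hiso : WeierstrassCurve.IsIsogenous V W) (hN : 2 ^ 2 ∣ N) : ¬ (2 : ℤ) ∣ D.maninConstant :=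
  not_dvd_maninConstant₁_of_rootLaw_of_witness D hopt
    (rootLawAtTwo_on_cmClass_seven_of_classMembers h159 hcl hL W D.f D.L D.isNewformOf D.isNeronLattice V hjV hiso hN)
    (exists_primitive_witness D.L 2)

/-- **COR 51.S₃ — the `3`-part of Stevens' `c₁ = ±1` for the `X₁(N)`-optimal curve of EVERY `ℚ(√−7)`-CM class with
`9 ∣ N`** (E-es-157 + SHAPE₇⁺ + Faltings; closes residual R49 of §49 on `ℚ(√−7)`). -/
theorem not_three_dvd_maninConstant₁_on_cmClass_seven_of_rootLawAtThree (h157 : CMGammaOneRootLawThreeLocalJInert)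
    (hcl : CMClassMembersSeven) (hL : LFunction_eq_of_isIsogenous)
    (W : WeierstrassCurve ℚ) [W.IsElliptic] [W.IsGloballyMinimal] (D : Gamma1ParametrizationData W N)
    (hopt : D.IsOptimal) (V : WeierstrassCurve ℚ) [V.IsElliptic] [V.IsGloballyMinimal] (hjV : V.j = -3375)
    (hiso : WeierstrassCurve.IsIsogenous V W) (hN : 3 ^ 2 ∣ N) : ¬ (3 : ℤ) ∣ D.maninConstant :=
  not_dvd_maninConstant₁_of_rootLaw_of_witness D hopt
    (rootLawAtThree_on_cmClass_seven_of_classMembers h157 hcl hL W D.f D.L D.isNewformOf D.isNeronLattice V hjV hiso hN)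
    (exists_primitive_witness D.L 3)

/-- **COR 51.R₂ — C2 (`2 ∤ c₀`) for `X₀(N)`-data on EVERY member of a `ℚ(√−7)`-CM class with `4 ∣ N`**, given a second
traceless prime `q ≠ 2` with `q² ∣ N` (always available: `q = 7`, `49 ∣ N`). -/
theorem not_two_dvd_maninConstant_on_cmClass_seven_of_rootLawAtTwo (h159 : CMGammaOneRootLawTwoLocalJSqrt7)
    (hcl : CMClassMembersSeven) (hL : LFunction_eq_of_isIsogenous)
    (W : WeierstrassCurve ℚ) [W.IsElliptic] [W.IsGloballyMinimal] (D : ModularParametrizationData W N)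
    (hD : ∀ z ∈ D.L.lattice, ∃ w ∈ periodLattice D.f, z = D.c * w)
    (V : WeierstrassCurve ℚ) [V.IsElliptic] [V.IsGloballyMinimal] (hjV : V.j = -3375)
    (hiso : WeierstrassCurve.IsIsogenous V W)
    {q : ℕ} (hq : q.Prime) (hq2 : q ≠ 2) (h4 : 2 ^ 2 ∣ N) (hqN : q ^ 2 ∣ N) :
    ¬ (2 : ℤ) ∣ D.maninConstant := by
  have hfW : IsNewformOf W D.f := D.isNewformOf
  have heq := ModularForms.gamma1LatticeEqOfTwoTracelessPrimes_holds N D.f hfW.1 2 q Nat.prime_two hq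
    (Ne.symm hq2) ((dvd_pow_self 2 two_ne_zero).trans h4) ((dvd_pow_self q two_ne_zero).trans hqN)
    (hfW.1.cuspCoeff_eq_zero_of_sq_dvd Nat.prime_two h4) (hfW.1.cuspCoeff_eq_zero_of_sq_dvd hq hqN)
  have hlaw := rootLawAtTwo_on_cmClass_seven_of_classMembers h159 hcl hL W D.f D.L hfW D.isNeronLattice V hjV hiso h4
  obtain ⟨z, hz, hzM⟩ := exists_primitive_witness D.L 2
  refine not_dvd_maninConstant_of_saturated_mem_of_witness D hD Int.prime_two D.L.lattice
    (fun γ => hlaw _ ?_) ⟨z, hz, fun s hs m hm => ?_⟩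
  · rw [heq]; unfold periodLattice; exact AddSubgroup.subset_closure ⟨γ, rfl⟩
  · exact_mod_cast hzM s hs m hm

/-- **COR 51.R₃ — C3 (`3 ∤ c₀`) for `X₀(N)`-data on EVERY member of a `ℚ(√−7)`-CM class with `9 ∣ N`**, given a
second traceless prime `q ≠ 3` with `q² ∣ N` (`q = 7` always). -/
theorem not_three_dvd_maninConstant_on_cmClass_seven_of_rootLawAtThree (h157 : CMGammaOneRootLawThreeLocalJInert)
    (hcl : CMClassMembersSeven) (hL : LFunction_eq_of_isIsogenous)
    (W : WeierstrassCurve ℚ) [W.IsElliptic] [W.IsGloballyMinimal] (D : ModularParametrizationData W N)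
    (hD : ∀ z ∈ D.L.lattice, ∃ w ∈ periodLattice D.f, z = D.c * w)
    (V : WeierstrassCurve ℚ) [V.IsElliptic] [V.IsGloballyMinimal] (hjV : V.j = -3375)
    (hiso : WeierstrassCurve.IsIsogenous V W)
    {q : ℕ} (hq : q.Prime) (hq3 : q ≠ 3) (h9 : 3 ^ 2 ∣ N) (hqN : q ^ 2 ∣ N) :
    ¬ (3 : ℤ) ∣ D.maninConstant := by
  have hfW : IsNewformOf W D.f := D.isNewformOf
  have heq := ModularForms.gamma1LatticeEqOfTwoTracelessPrimes_holds N D.f hfW.1 3 q Nat.prime_three hq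
    (Ne.symm hq3) ((dvd_pow_self 3 two_ne_zero).trans h9) ((dvd_pow_self q two_ne_zero).trans hqN)
    (hfW.1.cuspCoeff_eq_zero_of_sq_dvd Nat.prime_three h9) (hfW.1.cuspCoeff_eq_zero_of_sq_dvd hq hqN)
  have hlaw := rootLawAtThree_on_cmClass_seven_of_classMembers h157 hcl hL W D.f D.L hfW D.isNeronLattice V hjV hiso h9
  obtain ⟨z, hz, hzM⟩ := exists_primitive_witness D.L 3
  refine not_dvd_maninConstant_of_saturated_mem_of_witness D hD Int.prime_three D.L.lattice
    (fun γ => hlaw _ ?_) ⟨z, hz, fun s hs m hm => ?_⟩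
  · rw [heq]; unfold periodLattice; exact AddSubgroup.subset_closure ⟨γ, rfl⟩
  · exact_mod_cast hzM s hs m hm

end ClassSeven

end Summit.BirchSwinnertonDyer.Rank1Residual.ManinAdditive.KatoCurve.CMTwinMinimal

end
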